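import Mathlib
import HarnessLib
import Summits.HubbardSuperconductivity.HubbardSuperconductivity.Theorems.KLProgrammePerturbedFermiCurveFrameHessBridge

/-!
# Route `KLProgramme` — ENGINE child (stmt-HubbardSuperconductivity-20437 `KLRegimeEngineV17F2`): the Gauss map of the frame's Fermi curve is
# EXPANDING ON THE TORUS — `c·‖θ − θ′‖_{𝕋¹} ≤ ‖α(θ) − α(θ′)‖_{𝕋¹}` — the injectivity modulus of the normal direction (brick (T1)-input of the
# `TwoShellFrameAreaAt` witness, design note HOME/hubbard-kl-k3c2-p2/TWO-SHELL-FRAME-PORT.md)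

Cell `gate-hubbard-kl`, seat hubbard-kl-k3c2-p2 g15; companion of `…PerturbedFermiCurveFrameHessBridge` (rate `α′ ≥ c = u_min·w/(4+κ₁)` on ℝ) and of p4's
`…PerturbedNormalAngleLipschitz` (the UPPER twin `torusDist_normalAngleFn_le`).  The transversality alternative of the two-shell bound needs the converse
of Lipschitz: two points of the curve whose normals are (nearly) parallel are (nearly) equal or antipodal.  With `α(θ + 2πk) = α(θ) + 2πk`
(`normalAngleFn_add_int_mul_two_pi`) the real-line expansion passes to the circle:
* `torusDist_sub_ge_of_expand` — GENERIC: `f(x + 2πk) = f(x) + 2πk` and `c·(y − x) ≤ f y − f x` (`x ≤ y`, `0 ≤ c`) ⇒ `c·‖x − y‖_𝕋 ≤ ‖f x − f y‖_𝕋`;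
* **`torusDist_normalAngleFn_sub_ge_of_hessFloor`** / **`…_of_geomConstants`** — for a `2π`-periodic root selection of the perturbed curve:
  `(u_min·w/(4+κ₁))·‖θ − θ′‖_𝕋 ≤ ‖α(θ) − α(θ′)‖_𝕋`;
* `torusDist_normalAngle_perturbed_ge_of_geomConstants` — chart form for `u := perturbedFermiRadius δ_K ν` (companion of `normalAngle_perturbed_lipschitz`).
Everything is PROVED; no definitions, no named facts; nothing asserts any stub or superconductivity.
References: BGM 2003 §7.1 Lemma 7.1 (A1.9) [cite: BenfattoGiulianiMastropietro2003]; FST II §2.2 [cite: FeldmanSalmhoferTrubowitz1998].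
-/

noncomputable section

namespace Summit.HubbardSuperconductivity.HubbardSuperconductivity.Theorems.PerturbedFermiCurve

set_option linter.dupNamespace false -- summit = problem name (single-conjunct summit), D-0017

open Real Set
open Literature.MathematicalPhysics.QuantumLattice Literature.MathematicalPhysics.QuantumLattice.BandSectorCounting
open Literature.MathematicalPhysics.QuantumLattice.FermiRG
open Summit.HubbardSuperconductivity.HubbardSuperconductivity.Theorems.DispersionFlow
open Summit.HubbardSuperconductivity.HubbardSuperconductivity.Theorems.KLRegimeSplit

/-! ## §1 Generic: a degree-one expanding circle map expands the torus distance -/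

/-- **Expansion on the torus from expansion on the line**: if `f(x + 2πk) = f(x) + 2πk` for all `k : ℤ` and `c·(y − x) ≤ f y − f x` for `x ≤ y`
(`0 ≤ c`), then `c·‖x − y‖_{𝕋¹} ≤ ‖f x − f y‖_{𝕋¹}`. [folklore] -/
theorem torusDist_sub_ge_of_expand {f : ℝ → ℝ} {c : ℝ} (hc : 0 ≤ c) (hper : ∀ (x : ℝ) (k : ℤ), f (x + k * (2 * π)) = f x + k * (2 * π))
    (hexp : ∀ x y : ℝ, x ≤ y → c * (y - x) ≤ f y - f x) (x y : ℝ) :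
    c * torusDist (x - y) ≤ torusDist (f x - f y) := by
  obtain ⟨k, hk⟩ := exists_torusDist_eq_abs (f x - f y)
  -- move `y` by `-2πk`: `f x − f y + 2πk = f x − f (y − 2πk)`
  set y' : ℝ := y + (-k : ℤ) * (2 * π) with hy'
  have hfy' : f y' = f y + (-k : ℤ) * (2 * π) := by rw [hy']; exact hper y (-k)
  have hrepr : f x - f y + k * (2 * π) = f x - f y' := by rw [hfy']; push_cast; ring
  rw [hk, hrepr]
  -- real-line expansion, both orders
  have hline : c * |x - y'| ≤ |f x - f y'| := by
    rcases le_total x y' with h | h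
    · have h1 := hexp x y' h
      rw [abs_of_nonpos (sub_nonpos.2 h), abs_sub_comm, abs_of_nonneg (by nlinarith [sub_nonneg.2 h])]
      linarith
    · have h1 := hexp y' x h
      rw [abs_of_nonneg (sub_nonneg.2 h), abs_of_nonneg (by nlinarith [sub_nonneg.2 h])]
      linarith
  -- `‖x − y‖_𝕋 = ‖x − y′‖_𝕋 ≤ |x − y′|`
  have htor : torusDist (x - y) ≤ |x - y'| := by
    have e : x - y' = (x - y) + (k : ℤ) * (2 * π) := by rw [hy']; push_cast; ring
    rw [← torusDist_add_int_mul_two_pi (x - y) k, ← e]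
    exact torusDist_le_abs_self _
  calc c * torusDist (x - y) ≤ c * |x - y'| := mul_le_mul_of_nonneg_left htor hc
    _ ≤ |f x - f y'| := hline

/-! ## §2 The normal angle of the perturbed curve -/

section Root

variable {a b : ℝ} (B : BandBounds a b) {δ : (Fin 2 → ℝ) → ℝ} (hδs : ContDiff ℝ 2 δ)
  {κ₀ κ₁ μ : ℝ} (hδ : ∀ k : Fin 2 → ℝ, (∀ i, |k i| ≤ π) → |δ k| ≤ κ₀) (hlo : a ≤ μ - κ₀) (hhi : μ + κ₀ ≤ b)
  (hκ : ∀ k : Fin 2 → ℝ, (∀ i, |k i| ≤ π) → ‖fderiv ℝ δ k‖ ≤ κ₁) (hκ₁ : κ₁ < B.Dtmin)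
  {u : ℝ → ℝ} (hu : ∀ θ, IsBandFermiRadius (μ - δ (u θ • dir θ)) θ (u θ)) (hper : Function.Periodic u (2 * π))
include B hδs hδ hlo hhi hκ hκ₁ hu hper

/-- **Torus expansion of the Gauss map from a tangential-Hessian floor** (H) at every angle: `(u_min·w/(4+κ₁))·‖θ − θ′‖_𝕋 ≤ ‖α(θ) − α(θ′)‖_𝕋` for a
`2π`-periodic root selection. [cite: BenfattoGiulianiMastropietro2003, §7.1 Lemma 7.1 (A1.9)] -/
theorem torusDist_normalAngleFn_sub_ge_of_hessFloor {w : ℝ} (hw : 0 ≤ w)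
    (hH : ∀ θ, w * (VXE u θ ^ 2 + VYE u θ ^ 2) ≤
      2 * Real.cos (XE u θ) * VXE u θ ^ 2 + 2 * Real.cos (YE u θ) * VYE u θ ^ 2 +
        fderiv ℝ (fderiv ℝ δ) (u θ • dir θ) ![VXE u θ, VYE u θ] ![VXE u θ, VYE u θ]) (θ θ' : ℝ) :
    B.umin * w / (4 + κ₁) * torusDist (θ - θ') ≤
      torusDist ((θ - Real.arctan (deriv u θ / u θ)) - (θ' - Real.arctan (deriv u θ' / u θ'))) := by
  have hsq := abs_apply_le_pi_of_isBandFermiRadius (hu θ)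
  have hκ₁0 : 0 ≤ κ₁ := le_trans (norm_nonneg _) (hκ _ hsq)
  have hc : 0 ≤ B.umin * w / (4 + κ₁) := by have := B.umin_pos; positivity
  exact torusDist_sub_ge_of_expand (f := fun ϑ => ϑ - Real.arctan (deriv u ϑ / u ϑ)) hc
    (fun x k => normalAngleFn_add_int_mul_two_pi hper x k)
    (fun x y hxy => normalAngleFn_sub_ge_of_hessFloor B hδs hδ hlo hhi hκ hκ₁ hu hw hH hxy) θ θ'

end Root

section Frame

variable {a b : ℝ} (B : BandBounds a b) {K : TrigPolyC4v} {κ₀ κ₁ ν : ℝ}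
  (hδ : ∀ k : Fin 2 → ℝ, (∀ i, |k i| ≤ π) → |(fun k : Fin 2 → ℝ => -K.eval k) k| ≤ κ₀) (hlo : a ≤ ν - κ₀) (hhi : ν + κ₀ ≤ b)
  (hκ : ∀ k : Fin 2 → ℝ, (∀ i, |k i| ≤ π) → ‖fderiv ℝ (fun k : Fin 2 → ℝ => -K.eval k) k‖ ≤ κ₁) (hκ₁ : κ₁ < B.Dtmin)
  {μ Kc r₀ g₀ w : ℝ} (hG : GeomConstants (frameLevel μ K) Kc r₀ g₀ w) (hν : |ν - μ| < r₀)
include B hδ hlo hhi hκ hκ₁ hG hν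

/-- **Torus expansion of the Gauss map of the frame curve** for a `2π`-periodic root selection `u` of `{ε₀ + δ_K = ν}`, `|ν − μ| < r₀`:
`(u_min·w/(4+κ₁))·‖θ − θ′‖_𝕋 ≤ ‖α(θ) − α(θ′)‖_𝕋` — frame-uniform (`w = 3/200` under `FrameOK` (i)). [cite: BenfattoGiulianiMastropietro2003, §7.1 Lemma 7.1 (A1.9)] -/
theorem torusDist_normalAngleFn_sub_ge_of_geomConstants {u : ℝ → ℝ}
    (hu : ∀ θ, IsBandFermiRadius (ν - (fun k : Fin 2 → ℝ => -K.eval k) (u θ • dir θ)) θ (u θ)) (hper : Function.Periodic u (2 * π))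
    (θ θ' : ℝ) :
    B.umin * w / (4 + κ₁) * torusDist (θ - θ') ≤
      torusDist ((θ - Real.arctan (deriv u θ / u θ)) - (θ' - Real.arctan (deriv u θ' / u θ'))) := by
  have hsq := abs_apply_le_pi_of_isBandFermiRadius (hu θ)
  have hκ₁0 : 0 ≤ κ₁ := le_trans (norm_nonneg _) (hκ _ hsq)
  have hc : 0 ≤ B.umin * w / (4 + κ₁) := by have := B.umin_pos; have := hG.wmin_pos; positivity
  exact torusDist_sub_ge_of_expand (f := fun ϑ => ϑ - Real.arctan (deriv u ϑ / u ϑ)) hc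
    (fun x k => normalAngleFn_add_int_mul_two_pi hper x k)
    (fun x y hxy => normalAngleFn_sub_ge_of_geomConstants B hδ hlo hhi hκ hκ₁ hu hG hν hxy) θ θ'

/-- **Chart form**: for `u := perturbedFermiRadius δ_K ν` (the canonical root selection, `2π`-periodic by `perturbedFermiRadius_add_two_pi`),
`(u_min·w/(4+κ₁))·‖θ₂ − θ₁‖_𝕋 ≤ ‖α(θ₂,0) − α(θ₁,0)‖_𝕋` — the lower companion of p4's `normalAngle_perturbed_lipschitz`.
[cite: BenfattoGiulianiMastropietro2003, §7.1 Lemma 7.1 (A1.9)] -/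
theorem torusDist_normalAngle_perturbed_ge_of_geomConstants (θ₁ θ₂ : ℝ) :
    B.umin * w / (4 + κ₁) * torusDist (θ₂ - θ₁) ≤
      torusDist (BGM2003.normalAngle (fun ϑ e => perturbedFermiRadius (fun k : Fin 2 → ℝ => -K.eval k) (ν + e) ϑ) θ₂ 0 -
        BGM2003.normalAngle (fun ϑ e => perturbedFermiRadius (fun k : Fin 2 → ℝ => -K.eval k) (ν + e) ϑ) θ₁ 0) := by
  rw [normalAngle_perturbed_eq, normalAngle_perturbed_eq]
  have hδc : Continuous (fun k : Fin 2 → ℝ => -K.eval k) := (contDiff_frameShift_toLp K (m := 0)).continuous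
  have hu : ∀ θ, IsBandFermiRadius (ν - (fun k : Fin 2 → ℝ => -K.eval k) (perturbedFermiRadius (fun k : Fin 2 → ℝ => -K.eval k) ν θ • dir θ)) θ
      (perturbedFermiRadius (fun k : Fin 2 → ℝ => -K.eval k) ν θ) :=
    isBandFermiRadius_perturbedFermiRadius B hδc hδ hlo hhi
  exact torusDist_normalAngleFn_sub_ge_of_geomConstants B hδ hlo hhi hκ hκ₁ hG hν hu
    (fun θ => perturbedFermiRadius_add_two_pi _ ν θ) θ₂ θ₁

end Frame

end Summit.HubbardSuperconductivity.HubbardSuperconductivity.Theorems.PerturbedFermiCurve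

end
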